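import Literature.Analysis.Convexity.AnisotropicPerimeterPolytopePrism
import Literature.MeasureTheory.Integral.HPolyhedronFacetSum

/-!
# `PolycrystalWulffBound`, rung `rung_basalLamellar` — step 2a: Cavalieri in an orthonormal frame and
# thin slabs of a polytope along a facet plane (line `PolyDensity`, crux `stmt-Ventures-19482`)

Route `StickyWulffConstant` of the venture `Summits/Ventures/Crystal3D`, second prover lane (poly-p2,
gen 3).  Plumbing for the polyhedral anisotropic MINKOWSKI-CONTENT bound (`stub_lamellarMinkowskiUpper`
of the basal-lamellar skeleton): for an orthonormal frame `(U, V, n)` of `ℝ³`,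
* `volume_inter_slab_eq_lintegral` — CAVALIERI along `n`:
  `|S ∩ {t₀ < ⟪n,x⟫ < t₁}| = ∫_{(t₀,t₁)} |{y : ℝ × ℝ | y₁U + y₂V + t n ∈ S}| dt`;
* `volume_facetSlab_le` — for a bounded nonempty open `H`-polytope `Q` with unit normals and a
  constraint `(n, β)`: `|Q ∩ {β − s < ⟪n,x⟫}| ≤ s·(facetArea(closure Q ∩ {⟪n,x⟫ = β}) + ε)` for small
  `s` (sections converge to the facet: dominated convergence in the chart, tie lines are null).
WHAT THIS IS NOT: anything about textures or the crux.
-/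

noncomputable section

open scoped BigOperators InnerProductSpace ENNReal Pointwise
open MeasureTheory Set

namespace Summit.Ventures.Crystal3D.Theorems

/-- **Cavalieri along a unit normal.**  For an orthonormal frame `(U, V, n)` of `ℝ³` and a
measurable `S`: `|S ∩ {t₀ < ⟪n, x⟫ < t₁}| = ∫_{(t₀,t₁)} |{y : ℝ × ℝ | y₁U + y₂V + t n ∈ S}| dt`. -/
theorem volume_inter_slab_eq_lintegral {n U V : (EuclideanSpace ℝ (Fin 3))} (hn : ‖n‖ = 1) (hU : ‖U‖ = 1) (hV : ‖V‖ = 1)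
    (hUV : ⟪U, V⟫_ℝ = 0) (hnU : ⟪n, U⟫_ℝ = 0) (hnV : ⟪n, V⟫_ℝ = 0)
    {S : Set (EuclideanSpace ℝ (Fin 3))} (hS : MeasurableSet S) (t₀ t₁ : ℝ) :
    volume (S ∩ {x : (EuclideanSpace ℝ (Fin 3)) | t₀ < ⟪n, x⟫_ℝ ∧ ⟪n, x⟫_ℝ < t₁}) =
      ∫⁻ t in Set.Ioo t₀ t₁, volume {y : ℝ × ℝ | y.1 • U + y.2 • V + t • n ∈ S} := by
  classical
  have hon := Literature.Analysis.Convexity.orthonormal_vec_three hn hU hV hUV hnU hnV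
  have hsp : ⊤ ≤ Submodule.span ℝ (Set.range ![U, V, n]) :=
    (hon.linearIndependent.span_eq_top_of_card_eq_finrank (by simp)).ge
  set b : OrthonormalBasis (Fin 3) ℝ (EuclideanSpace ℝ (Fin 3)) := OrthonormalBasis.mk hon hsp with hb
  have hb0 : b 0 = U := by simp [hb]
  have hb1 : b 1 = V := by simp [hb]
  have hb2 : b 2 = n := by simp [hb]
  have hexp : ∀ z : (EuclideanSpace ℝ (Fin 3)), ⟪U, z⟫_ℝ • U + ⟪V, z⟫_ℝ • V + ⟪n, z⟫_ℝ • n = z := by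
    intro z
    have h := b.sum_repr' z
    simp only [Fin.sum_univ_three, hb0, hb1, hb2] at h
    exact h
  -- frame coordinates
  let e : (EuclideanSpace ℝ (Fin 3)) ≃ᵐ (Fin 3 → ℝ) :=
    b.repr.toHomeomorph.toMeasurableEquiv.trans (MeasurableEquiv.toLp 2 (Fin 3 → ℝ)).symm
  have he_apply : ∀ (x : (EuclideanSpace ℝ (Fin 3))) (i : Fin 3), e x i = ⟪b i, x⟫_ℝ := by
    intro x i
    simp only [e, MeasurableEquiv.coe_trans, Function.comp_apply,
      Homeomorph.toMeasurableEquiv_coe, LinearIsometryEquiv.coe_toHomeomorph,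
      MeasurableEquiv.toLp_symm_apply, OrthonormalBasis.repr_apply_apply]
  have he : MeasurePreserving e volume volume := by
    have hfun : (⇑e : (EuclideanSpace ℝ (Fin 3)) → (Fin 3 → ℝ)) = WithLp.ofLp ∘ ⇑b.repr := by funext x; rfl
    rw [hfun]
    exact (PiLp.volume_preserving_ofLp (Fin 3)).comp b.measurePreserving_repr
  let e₂ : (Fin 3 → ℝ) ≃ᵐ ℝ × (Fin 2 → ℝ) := MeasurableEquiv.piFinSuccAbove (fun _ => ℝ) 2
  have he₂ : MeasurePreserving e₂ volume volume := volume_preserving_piFinSuccAbove (fun _ => ℝ) 2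
  let e₃ : (Fin 2 → ℝ) ≃ᵐ ℝ × ℝ := MeasurableEquiv.finTwoArrow
  have he₃ : MeasurePreserving e₃ volume volume := volume_preserving_finTwoArrow ℝ
  have h20 : Fin.succAbove (2 : Fin 3) 0 = 0 := by decide
  have h21 : Fin.succAbove (2 : Fin 3) 1 = 1 := by decide
  -- the set in frame coordinates: `{(t, z) | t ∈ (t₀,t₁), z₀ U + z₁ V + t n ∈ S}`
  set D : Set (ℝ × (Fin 2 → ℝ)) := {q | q.1 ∈ Set.Ioo t₀ t₁ ∧ (q.2 0) • U + (q.2 1) • V + q.1 • n ∈ S}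
    with hD
  have hset : S ∩ {x : (EuclideanSpace ℝ (Fin 3)) | t₀ < ⟪n, x⟫_ℝ ∧ ⟪n, x⟫_ℝ < t₁} = e ⁻¹' (e₂ ⁻¹' D) := by
    ext x
    simp only [Set.mem_inter_iff, Set.mem_setOf_eq, Set.mem_preimage, hD,
      MeasurableEquiv.piFinSuccAbove_apply, Fin.insertNthEquiv_symm_apply, Fin.removeNth, h20, h21,
      he_apply, hb0, hb1, hb2, e₂, Set.mem_Ioo]
    rw [hexp x]
    tauto
  -- measurability of `D`
  have hφ : Measurable fun q : ℝ × (Fin 2 → ℝ) => (q.2 0) • U + (q.2 1) • V + q.1 • n := by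
    refine ((Measurable.smul_const ?_ U).add (Measurable.smul_const ?_ V)).add
      (Measurable.smul_const measurable_fst n)
    · exact (measurable_pi_apply 0).comp measurable_snd
    · exact (measurable_pi_apply 1).comp measurable_snd
  have hDm : MeasurableSet D :=
    (measurableSet_Ioo.preimage measurable_fst).inter (hS.preimage hφ)
  rw [hset, he.measure_preimage_equiv, he₂.measure_preimage_equiv, Measure.volume_eq_prod,
    Measure.prod_apply hDm]
  -- sections of `D`
  have hsec : ∀ t, Prod.mk t ⁻¹' D =
      if t ∈ Set.Ioo t₀ t₁ then e₃ ⁻¹' {y : ℝ × ℝ | y.1 • U + y.2 • V + t • n ∈ S} else ∅ := by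
    intro t
    split_ifs with ht
    · ext z
      simp only [hD, Set.mem_preimage, Set.mem_setOf_eq, e₃, MeasurableEquiv.finTwoArrow_apply]
      tauto
    · ext z
      simp only [hD, Set.mem_preimage, Set.mem_setOf_eq, Set.mem_empty_iff_false, iff_false]
      tauto
  have hSm : ∀ t : ℝ, MeasurableSet {y : ℝ × ℝ | y.1 • U + y.2 • V + t • n ∈ S} := by
    intro t
    have hψ : Measurable fun y : ℝ × ℝ => y.1 • U + y.2 • V + t • n :=
      ((measurable_fst.smul_const U).add (measurable_snd.smul_const V)).add_const _
    exact hS.preimage hψ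
  rw [← lintegral_indicator measurableSet_Ioo]
  refine lintegral_congr fun t => ?_
  rw [hsec t]
  by_cases ht : t ∈ Set.Ioo t₀ t₁
  · rw [if_pos ht, Set.indicator_of_mem ht, he₃.measure_preimage_equiv]
  · rw [if_neg ht, Set.indicator_of_notMem ht, measure_empty]

/-! ### Sections of a convex polytope near a facet plane -/

/-- **Thin slabs of an open `H`-polytope along one of its constraint planes.**  Let
`Q = ⋂_{q ∈ H'} {⟪q.1, ·⟫ < q.2}` be a bounded nonempty open `H`-polytope of `ℝ³` with unit normals and
`q₀ = (n, β) ∈ H'`.  Then for every `ε > 0` there is `δ > 0` with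
`|Q ∩ {β − s < ⟪n, x⟫}| ≤ s · (facetArea (closure Q ∩ {⟪n,x⟫ = β}) n + ε)` for `0 < s < δ`
(`facetArea F ν` = volume of the unit prism over `F`): the sections of `Q` parallel to the facet
plane converge in area to the facet (dominated convergence in a chart of the plane; tie lines are
null), and Cavalieri. -/
theorem volume_facetSlab_le (H' : Finset ((EuclideanSpace ℝ (Fin 3)) × ℝ))
    (hbd : Bornology.IsBounded (⋂ q ∈ H', {x : EuclideanSpace ℝ (Fin 3) | ⟪q.1, x⟫_ℝ < q.2}))
    (hne : (⋂ q ∈ H', {x : EuclideanSpace ℝ (Fin 3) | ⟪q.1, x⟫_ℝ < q.2}).Nonempty)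
    (hunit : ∀ q ∈ H', ‖q.1‖ = 1) {q₀ : (EuclideanSpace ℝ (Fin 3)) × ℝ} (hq₀ : q₀ ∈ H')
    {ε : ℝ} (hε : 0 < ε) :
    ∃ δ : ℝ, 0 < δ ∧ ∀ s : ℝ, 0 < s → s < δ →
      (volume ((⋂ q ∈ H', {x : EuclideanSpace ℝ (Fin 3) | ⟪q.1, x⟫_ℝ < q.2}) ∩
        {x : EuclideanSpace ℝ (Fin 3) | q₀.2 - s < ⟪q₀.1, x⟫_ℝ})).toReal ≤
        s * ((volume {x : EuclideanSpace ℝ (Fin 3) | ∃ y ∈ closure (⋂ q ∈ H',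
            {x : EuclideanSpace ℝ (Fin 3) | ⟪q.1, x⟫_ℝ < q.2}) ∩ {x | ⟪q₀.1, x⟫_ℝ = q₀.2},
            ∃ t ∈ Set.Icc (0 : ℝ) 1, x = y + t • q₀.1}).toReal + ε) := by
  classical
  set Q : Set (EuclideanSpace ℝ (Fin 3)) := ⋂ q ∈ H', {x : EuclideanSpace ℝ (Fin 3) | ⟪q.1, x⟫_ℝ < q.2}
    with hQ
  set n : EuclideanSpace ℝ (Fin 3) := q₀.1 with hn
  set β : ℝ := q₀.2 with hβ
  have hn1 : ‖n‖ = 1 := hunit q₀ hq₀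
  have hnn : ⟪n, n⟫_ℝ = 1 := by rw [real_inner_self_eq_norm_sq, hn1, one_pow]
  obtain ⟨U, V, hU, hV, hUV, hnU, hnV⟩ := Literature.Analysis.Convexity.exists_orthonormal_pair_perp n
  have hUn : ⟪U, n⟫_ℝ = 0 := by rw [real_inner_comm]; exact hnU
  have hVn : ⟪V, n⟫_ℝ = 0 := by rw [real_inner_comm]; exact hnV
  have hVU : ⟪V, U⟫_ℝ = 0 := by rw [real_inner_comm]; exact hUV
  obtain ⟨hUU, hVV⟩ : ⟪U, U⟫_ℝ = 1 ∧ ⟪V, V⟫_ℝ = 1 :=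
    ⟨by rw [real_inner_self_eq_norm_sq, hU, one_pow], by rw [real_inner_self_eq_norm_sq, hV, one_pow]⟩
  -- the chart of the plane at height `t`
  set Φ : ℝ → ℝ × ℝ → EuclideanSpace ℝ (Fin 3) := fun t y => y.1 • U + y.2 • V + t • n with hΦ
  have hΦq : ∀ (q : (EuclideanSpace ℝ (Fin 3)) × ℝ) (t : ℝ) (y : ℝ × ℝ),
      ⟪q.1, Φ t y⟫_ℝ = ⟪q.1, U⟫_ℝ * y.1 + ⟪q.1, V⟫_ℝ * y.2 + t * ⟪q.1, n⟫_ℝ := by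
    intro q t y
    simp only [hΦ, inner_add_right, real_inner_smul_right]
    ring
  have hΦn : ∀ t y, ⟪n, Φ t y⟫_ℝ = t := by
    intro t y
    rw [hΦq, hnU, hnV, hnn]; ring
  have hΦU : ∀ t y, ⟪U, Φ t y⟫_ℝ = y.1 := by
    intro t y
    simp only [hΦ, inner_add_right, real_inner_smul_right, hUU, hUV, hUn]; ring
  have hΦV : ∀ t y, ⟪V, Φ t y⟫_ℝ = y.2 := by
    intro t y
    simp only [hΦ, inner_add_right, real_inner_smul_right, hVU, hVV, hVn]; ring
  have hΦcont : ∀ y : ℝ × ℝ, Continuous fun t : ℝ => Φ t y := fun y => by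
    simp only [hΦ]; fun_prop
  have hΦmeas : ∀ t : ℝ, Measurable fun y : ℝ × ℝ => Φ t y := fun t =>
    (((measurable_fst.smul_const U).add (measurable_snd.smul_const V)).add_const _)
  -- sections and the two facet charts
  set sec : ℝ → Set (ℝ × ℝ) := fun t => {y | Φ t y ∈ Q} with hsec
  set O : Set (ℝ × ℝ) := {y | ∀ q ∈ H', q ≠ q₀ → ⟪q.1, Φ β y⟫_ℝ < q.2} with hO
  set Cl : Set (ℝ × ℝ) := {y | ∀ q ∈ H', ⟪q.1, Φ β y⟫_ℝ ≤ q.2} with hCl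
  have hOCl : O ⊆ Cl := by
    intro y hy q hq
    by_cases hqq : q = q₀
    · rw [hqq, ← hn, hΦn]
    · exact (hy q hq hqq).le
  -- the difference is a finite union of null tie lines
  have hnull : volume (Cl \ O) = 0 := by
    have hsub : Cl \ O ⊆ ⋃ q ∈ H'.erase q₀, {y : ℝ × ℝ | ⟪q.1, U⟫_ℝ * y.1 + ⟪q.1, V⟫_ℝ * y.2 =
        q.2 - β * ⟪q.1, n⟫_ℝ} := by
      intro y hy
      obtain ⟨hyC, hyO⟩ := hy
      simp only [hO, mem_setOf_eq, not_forall, not_lt] at hyO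
      obtain ⟨q, hq, hqq, hle⟩ := hyO
      have heq : ⟪q.1, Φ β y⟫_ℝ = q.2 := le_antisymm (hyC q hq) hle
      refine mem_iUnion₂.2 ⟨q, Finset.mem_erase.2 ⟨hqq, hq⟩, ?_⟩
      rw [mem_setOf_eq]
      rw [hΦq] at heq
      linarith
    refine measure_mono_null hsub ((measure_biUnion_null_iff (H'.erase q₀).countable_toSet).2 ?_)
    intro q hq
    obtain ⟨hqq, hqH⟩ := Finset.mem_erase.1 hq
    by_cases hc : ⟪q.1, U⟫_ℝ ≠ 0 ∨ ⟪q.1, V⟫_ℝ ≠ 0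
    · exact Literature.MeasureTheory.Integral.volume_affineLine_eq_zero hc
    · -- `q.1 ⊥ U, V`: then `q.1 = ±n`, and the tie set is empty
      push Not at hc
      obtain ⟨hcU, hcV⟩ := hc
      have hq1 : ‖q.1‖ = 1 := hunit q hqH
      -- expand `q.1` in the frame
      have hon := Literature.Analysis.Convexity.orthonormal_vec_three hn1 hU hV hUV hnU hnV
      have hsp : ⊤ ≤ Submodule.span ℝ (Set.range ![U, V, n]) :=
        (hon.linearIndependent.span_eq_top_of_card_eq_finrank (by simp)).ge
      set b : OrthonormalBasis (Fin 3) ℝ (EuclideanSpace ℝ (Fin 3)) := OrthonormalBasis.mk hon hsp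
        with hb
      have hexp : ⟪U, q.1⟫_ℝ • U + ⟪V, q.1⟫_ℝ • V + ⟪n, q.1⟫_ℝ • n = q.1 := by
        have h := b.sum_repr' q.1
        simp only [Fin.sum_univ_three, hb] at h
        simpa using h
      rw [real_inner_comm, hcU, real_inner_comm, hcV, zero_smul, zero_smul, zero_add, zero_add] at hexp
      set μ : ℝ := ⟪n, q.1⟫_ℝ with hμ
      have hμ2 : μ ^ 2 = 1 := by
        have : ‖q.1‖ ^ 2 = μ ^ 2 := by
          rw [← hexp, norm_smul, mul_pow, hn1, Real.norm_eq_abs, sq_abs]; ring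
        rw [hq1, one_pow] at this
        exact this.symm
      have hqn : ⟪q.1, n⟫_ℝ = μ := by rw [real_inner_comm]
      -- the tie equation reads `0 = q.2 − β μ`
      have hempty : {y : ℝ × ℝ | ⟪q.1, U⟫_ℝ * y.1 + ⟪q.1, V⟫_ℝ * y.2 = q.2 - β * ⟪q.1, n⟫_ℝ} = ∅ := by
        ext y
        simp only [hcU, hcV, zero_mul, add_zero, mem_setOf_eq, mem_empty_iff_false, iff_false, hqn]
        intro h0
        -- `μ = ±1`
        have hμ1 : μ = 1 ∨ μ = -1 := by
          have : (μ - 1) * (μ + 1) = 0 := by nlinarith [hμ2]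
          rcases mul_eq_zero.1 this with h | h
          · left; linarith
          · right; linarith
        obtain ⟨x₀, hx₀⟩ := hne
        have hx₀' := mem_iInter₂.1 hx₀
        have hq₀x : ⟪n, x₀⟫_ℝ < β := hx₀' q₀ hq₀
        have hqx : ⟪q.1, x₀⟫_ℝ < q.2 := hx₀' q hqH
        rcases hμ1 with h1 | h1
        · -- `q.1 = n`, `q.2 = β`: then `q = q₀`
          rw [h1, one_smul] at hexp
          rw [h1, mul_one] at h0
          have h2 : q.2 = q₀.2 := by rw [← hβ]; linarith
          exact hqq (Prod.ext (hexp.symm.trans hn) h2)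
        · -- `q.1 = −n`, `q.2 = −β`: `Q` would be empty
          rw [h1, neg_one_smul] at hexp
          rw [h1] at h0
          rw [← hexp, inner_neg_left] at hqx
          linarith
      rw [hempty, measure_empty]
  -- `Q` is bounded: sections live in a square
  obtain ⟨R₁, hR₁⟩ := hbd.subset_closedBall 0
  set B : Set (ℝ × ℝ) := Set.Icc (-‖R₁‖ - 1) (‖R₁‖ + 1) ×ˢ Set.Icc (-‖R₁‖ - 1) (‖R₁‖ + 1) with hB
  have hBfin : volume B ≠ ⊤ := by
    rw [hB, Measure.volume_eq_prod, Measure.prod_prod, Real.volume_Icc]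
    exact ENNReal.mul_ne_top ENNReal.ofReal_ne_top ENNReal.ofReal_ne_top
  have hsecB : ∀ t, sec t ⊆ B := by
    intro t y hy
    have hyQ : Φ t y ∈ Q := hy
    have hnorm : ‖Φ t y‖ ≤ ‖R₁‖ := le_trans (mem_closedBall_zero_iff.1 (hR₁ hyQ)) (Real.le_norm_self _)
    have h1 : |y.1| ≤ ‖R₁‖ := by
      rw [← hΦU t y]; exact le_trans (abs_real_inner_le_norm _ _) (by rw [hU, one_mul]; exact hnorm)
    have h2 : |y.2| ≤ ‖R₁‖ := by
      rw [← hΦV t y]; exact le_trans (abs_real_inner_le_norm _ _) (by rw [hV, one_mul]; exact hnorm)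
    rw [abs_le] at h1 h2
    exact ⟨⟨by linarith, by linarith⟩, ⟨by linarith, by linarith⟩⟩
  have hOB : O ⊆ B := by
    intro y hy
    -- `Φ β y ∈ closure Q ⊆ closedBall 0 R₁`
    have hcl : Φ β y ∈ closure Q := by
      rw [hQ, Literature.Analysis.Convexity.closure_iInter_halfSpace_lt H' (fun q => q.1) (fun q => q.2) hne]
      exact mem_iInter₂.2 fun q hq => hOCl hy q hq
    have hnorm : ‖Φ β y‖ ≤ ‖R₁‖ :=
      le_trans (mem_closedBall_zero_iff.1 ((Metric.isClosed_closedBall.closure_subset_iff.2 hR₁) hcl))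
        (Real.le_norm_self _)
    have h1 : |y.1| ≤ ‖R₁‖ := by
      rw [← hΦU β y]; exact le_trans (abs_real_inner_le_norm _ _) (by rw [hU, one_mul]; exact hnorm)
    have h2 : |y.2| ≤ ‖R₁‖ := by
      rw [← hΦV β y]; exact le_trans (abs_real_inner_le_norm _ _) (by rw [hV, one_mul]; exact hnorm)
    rw [abs_le] at h1 h2
    exact ⟨⟨by linarith, by linarith⟩, ⟨by linarith, by linarith⟩⟩
  -- openness / measurability
  have hQopen : IsOpen Q := isOpen_biInter_finset fun q _ =>
    isOpen_lt (continuous_const.inner continuous_id) continuous_const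
  have hsecm : ∀ t, MeasurableSet (sec t) := fun t => hQopen.measurableSet.preimage (hΦmeas t)
  have hOm : MeasurableSet O := by
    have : O = ⋂ q ∈ H'.erase q₀, {y : ℝ × ℝ | ⟪q.1, Φ β y⟫_ℝ < q.2} := by
      ext y
      simp only [hO, mem_setOf_eq, mem_iInter, Finset.mem_erase]
      constructor
      · intro h q hq; exact h q hq.2 hq.1
      · intro h q hq hqq; exact h q ⟨hqq, hq⟩
    rw [this]
    exact MeasurableSet.biInter (H'.erase q₀).countable_toSet fun q _ =>
      measurableSet_lt ((measurable_const.inner measurable_id).comp (hΦmeas β)) measurable_const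
  -- pointwise convergence of the sections to the open facet chart, off the tie lines
  have hconv : ∀ᵐ y ∂(volume : Measure (ℝ × ℝ)), ∀ᶠ t in nhdsWithin β (Set.Iio β),
      (sec t).indicator (1 : ℝ × ℝ → ℝ≥0∞) y = O.indicator 1 y := by
    have hgood : ∀ y, y ∉ Cl \ O → ∀ᶠ t in nhdsWithin β (Set.Iio β),
        (sec t).indicator (1 : ℝ × ℝ → ℝ≥0∞) y = O.indicator 1 y := by
      intro y hy
      by_cases hyO : y ∈ O
      · -- eventually inside
        have hev : ∀ q ∈ H'.erase q₀, ∀ᶠ t in nhdsWithin β (Set.Iio β), ⟪q.1, Φ t y⟫_ℝ < q.2 := by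
          intro q hq
          obtain ⟨hqq, hqH⟩ := Finset.mem_erase.1 hq
          have hlt : ⟪q.1, Φ β y⟫_ℝ < q.2 := hyO q hqH hqq
          have hc : Continuous fun t : ℝ => ⟪q.1, Φ t y⟫_ℝ := continuous_const.inner (hΦcont y)
          exact nhdsWithin_le_nhds ((hc.tendsto β).eventually (gt_mem_nhds hlt))
        have hall := (H'.erase q₀).eventually_all.2 hev
        have hlt : ∀ᶠ t in nhdsWithin β (Set.Iio β), t < β := self_mem_nhdsWithin
        filter_upwards [hall, hlt] with t ht htβ
        have hmem : y ∈ sec t := by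
          show Φ t y ∈ Q
          refine mem_iInter₂.2 fun q hq => ?_
          by_cases hqq : q = q₀
          · show ⟪q.1, Φ t y⟫_ℝ < q.2
            rw [hqq, ← hn, ← hβ, hΦn]; exact htβ
          · exact ht q (Finset.mem_erase.2 ⟨hqq, hq⟩)
        rw [indicator_of_mem hmem, indicator_of_mem hyO]
      · -- `y ∉ Cl`: eventually outside
        have hyC : y ∉ Cl := fun h => hy ⟨h, hyO⟩
        simp only [hCl, mem_setOf_eq, not_forall, not_le] at hyC
        obtain ⟨q, hq, hgt⟩ := hyC
        have hc : Continuous fun t : ℝ => ⟪q.1, Φ t y⟫_ℝ := continuous_const.inner (hΦcont y)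
        have hev : ∀ᶠ t in nhdsWithin β (Set.Iio β), q.2 < ⟪q.1, Φ t y⟫_ℝ :=
          nhdsWithin_le_nhds ((hc.tendsto β).eventually (lt_mem_nhds hgt))
        filter_upwards [hev] with t ht
        have hnm : y ∉ sec t := by
          intro hmem
          have := mem_iInter₂.1 (show Φ t y ∈ Q from hmem) q hq
          exact absurd this (not_lt.2 ht.le)
        rw [indicator_of_notMem hnm, indicator_of_notMem hyO]
    have : {y | ¬ ∀ᶠ t in nhdsWithin β (Set.Iio β),
        (sec t).indicator (1 : ℝ × ℝ → ℝ≥0∞) y = O.indicator 1 y} ⊆ Cl \ O := by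
      intro y hy
      by_contra h
      exact hy (hgood y h)
    exact measure_mono_null this hnull
  -- dominated convergence: section areas → |O|
  have htend : Filter.Tendsto (fun t => volume (sec t)) (nhdsWithin β (Set.Iio β)) (nhds (volume O)) := by
    have h := tendsto_lintegral_filter_of_dominated_convergence (μ := (volume : Measure (ℝ × ℝ)))
      (l := nhdsWithin β (Set.Iio β))
      (F := fun t => (sec t).indicator (1 : ℝ × ℝ → ℝ≥0∞)) (f := O.indicator 1) (B.indicator 1)
      (Filter.Eventually.of_forall fun t => (measurable_one.indicator (hsecm t)))
      (Filter.Eventually.of_forall fun t => Filter.Eventually.of_forall fun y => by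
        exact indicator_le_indicator_of_subset (hsecB t) (fun _ => zero_le_one) y)
      (by rw [lintegral_indicator_one ((measurableSet_Icc.prod measurableSet_Icc))]; exact hBfin)
      (by
        filter_upwards [hconv] with y hy
        exact tendsto_const_nhds.congr' (hy.mono fun t ht => ht.symm))
    simp only [lintegral_indicator_one (hsecm _), lintegral_indicator_one hOm] at h
    exact h
  have hOfin : volume O ≠ ⊤ := (lt_of_le_of_lt (measure_mono hOB) (lt_top_iff_ne_top.2 hBfin)).ne
  -- eventually the section areas are below `|O| + ε`
  have hev : ∀ᶠ t in nhdsWithin β (Set.Iio β), volume (sec t) ≤ volume O + ENNReal.ofReal ε := by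
    have h := (ENNReal.tendsto_nhds hOfin).1 htend (ENNReal.ofReal ε) (ENNReal.ofReal_pos.2 hε)
    filter_upwards [h] with t ht using ht.2
  obtain ⟨δ₀, hδ₀, hδ⟩ : ∃ δ₀, δ₀ < β ∧ ∀ t, δ₀ < t → t < β → volume (sec t) ≤ volume O + ENNReal.ofReal ε := by
    obtain ⟨l, hl, hsub⟩ := (mem_nhdsLT_iff_exists_Ioo_subset).1 hev
    exact ⟨l, hl, fun t h1 h2 => hsub ⟨h1, h2⟩⟩
  -- the facet area: `|O| = |Cl| =` prism volume
  have hvolO : volume O = volume Cl := by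
    apply le_antisymm (measure_mono hOCl)
    calc volume Cl ≤ volume (O ∪ (Cl \ O)) := measure_mono (fun y hy => by
            by_cases h : y ∈ O
            · exact Or.inl h
            · exact Or.inr ⟨hy, h⟩)
      _ ≤ volume O + volume (Cl \ O) := measure_union_le _ _
      _ = volume O := by rw [hnull, add_zero]
  have hClF : Cl = {y : ℝ × ℝ | β • n + y.1 • U + y.2 • V ∈ closure Q ∩ {x | ⟪n, x⟫_ℝ = β}} := by
    have hcl := Literature.Analysis.Convexity.closure_iInter_halfSpace_lt H' (fun q => q.1) (fun q => q.2) hne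
    ext y
    have hpt : β • n + y.1 • U + y.2 • V = Φ β y := by simp only [hΦ]; abel
    simp only [hCl, mem_setOf_eq, mem_inter_iff, hpt, hΦn, and_true]
    rw [hQ, hcl, mem_iInter₂]
    simp only [mem_setOf_eq]
  have hprism : volume {x : EuclideanSpace ℝ (Fin 3) | ∃ y ∈ closure Q ∩ {x | ⟪n, x⟫_ℝ = β},
      ∃ t ∈ Set.Icc (0 : ℝ) 1, x = y + t • n} = volume Cl := by
    rw [hClF]
    exact Literature.Analysis.Convexity.volume_prism_eq_volume_chartPreimage hn1 hU hV hUV hnU hnV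
      (p := β • n) (fun y hy => by rw [hy.2, real_inner_smul_right, hnn, mul_one])
  -- conclusion
  refine ⟨β - δ₀, by linarith, fun s hs hsδ => ?_⟩
  have hslab : Q ∩ {x : EuclideanSpace ℝ (Fin 3) | β - s < ⟪n, x⟫_ℝ} =
      Q ∩ {x | β - s < ⟪n, x⟫_ℝ ∧ ⟪n, x⟫_ℝ < β} := by
    ext x
    simp only [mem_inter_iff, mem_setOf_eq]
    constructor
    · rintro ⟨hxQ, hxs⟩
      exact ⟨hxQ, hxs, mem_iInter₂.1 hxQ q₀ hq₀⟩
    · rintro ⟨hxQ, hxs, -⟩; exact ⟨hxQ, hxs⟩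
  have hcav := volume_inter_slab_eq_lintegral hn1 hU hV hUV hnU hnV hQopen.measurableSet (β - s) β
  have hbound : ∫⁻ t in Set.Ioo (β - s) β, volume (sec t) ≤
      ∫⁻ _ in Set.Ioo (β - s) β, (volume O + ENNReal.ofReal ε) := by
    refine setLIntegral_mono measurable_const fun t ht => hδ t (by linarith [ht.1]) ht.2
  rw [setLIntegral_const, Real.volume_Ioo, show β - (β - s) = s by ring] at hbound
  show (volume (Q ∩ {x : EuclideanSpace ℝ (Fin 3) | β - s < ⟪n, x⟫_ℝ})).toReal ≤
    s * ((volume {x : EuclideanSpace ℝ (Fin 3) | ∃ y ∈ closure Q ∩ {x | ⟪n, x⟫_ℝ = β},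
      ∃ t ∈ Set.Icc (0 : ℝ) 1, x = y + t • n}).toReal + ε)
  rw [hslab, hcav, hprism, ← hvolO]
  have hfin : (volume O + ENNReal.ofReal ε) * ENNReal.ofReal s ≠ ⊤ :=
    ENNReal.mul_ne_top (ENNReal.add_ne_top.2 ⟨hOfin, ENNReal.ofReal_ne_top⟩) ENNReal.ofReal_ne_top
  calc (∫⁻ t in Set.Ioo (β - s) β, volume (sec t)).toReal
      ≤ ((volume O + ENNReal.ofReal ε) * ENNReal.ofReal s).toReal := ENNReal.toReal_mono hfin hbound
    _ = s * ((volume O).toReal + ε) := by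
        rw [ENNReal.toReal_mul, ENNReal.toReal_add hOfin ENNReal.ofReal_ne_top,
          ENNReal.toReal_ofReal hε.le, ENNReal.toReal_ofReal hs.le]
        ring

end Summit.Ventures.Crystal3D.Theorems

end
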